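import Literature.NumberTheory.CubicFields.DeloneFaddeevEquivariance
import Mathlib.RingTheory.AdjoinRoot
import Mathlib.Algebra.Polynomial.SpecificDegree
import Mathlib.Algebra.Ring.Hom.InjSurj
import Mathlib.RingTheory.Coprime.Lemmas
import HarnessLib

/-!
# Irreducible binary cubic forms correspond to cubic rings that are integral domains (Levi–Delone–Faddeev)

Topic `Literature/NumberTheory/CubicFields`, continuing `DeloneFaddeevRing.lean` (`R(f)`) and
`DeloneFaddeevEquivariance.lean` (`R(f ∘ γ) ≅ R(f)` for `γ ∈ SL₂(ℤ)`).

Bhargava–Taniguchi–Thorne 2023, Thm 2.1, second clause: "Under this correspondence, irreducible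
cubic forms correspond to orders in cubic fields" — where (§2.2) "a cubic form `f` is irreducible
if `f(u, v)` is irreducible as a polynomial over `ℚ`", and (§2.1) a cubic ring is an order in a
cubic field iff it is an integral domain (then it is an order in its fraction field). This file
proves the ring-theoretic content:

* `BinaryCubic.IsIrreducible f` — `f(u,v)` is irreducible over `ℚ`, in the dehomogenized form
  "`v ∤ f` (i.e. `a ≠ 0`) and `f(u, 1)` is irreducible in `ℚ[u]`", with the elementary
  characterization `isIrreducible_iff_eval_ne_zero`: **`f` is irreducible iff it has no zero in
  `P¹(ℚ)`**, i.e. `f(u, v) ≠ 0` for all integers `(u, v) ≠ (0, 0)`;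
* `RingOfForm.a_ne_zero_of_isDomain` — if `a = 0` then `ωθ = −ad = 0`: zero divisors;
* `RingOfForm.toAdjoinRoot` — for `a ≠ 0`, the ring homomorphism `R(f) → ℚ[x]/(f(x,1))`,
  `ω ↦ −aα`, `θ ↦ −(aα² + bα + c)` (`α` the class of `x`), which is injective
  (`toAdjoinRoot_injective`);
* `RingOfForm.isDomain_iff_isIrreducible` — **`R(f)` is an integral domain iff `f` is
  irreducible over `ℚ`** (BTT Thm 2.1, clause 2).

NOT here: `Frac R(f)` is the cubic field `ℚ[x]/(f(x,1))` (degree `3`), maximality (Prop. 2.2),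
`Stab(f) ≅ Aut(R)`.

## References

* M. Bhargava, T. Taniguchi, F. Thorne, *Improved error estimates for the Davenport–Heilbronn
  theorems*, Math. Ann. 389 (2024) = arXiv:2107.12819, §2.1–2.2 and Thm 2.1 [BhargavaTaniguchiThorne2023].
* M. Bhargava, A. Shankar, J. Tsimerman, *On the Davenport–Heilbronn theorems and second order
  terms*, Invent. Math. 193 (2013), §2 [BhargavaShankarTsimerman2012].
* W. T. Gan, B. Gross, G. Savin, *Fourier coefficients of modular forms on `G₂`*, Duke Math. J.
  115 (2002), §4 [GanGrossSavin2002].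
-/

namespace Literature.NumberTheory.CubicFields

open Polynomial

namespace BinaryCubic

/-- The rational cubic polynomial `f(u, 1) = a u³ + b u² + c u + d ∈ ℚ[u]`. [folklore] -/
noncomputable def ratPoly (f : BinaryCubic ℤ) : ℚ[X] :=
  (f.map (Int.castRingHom ℚ)).toCubic.toPoly

/-- `f(u,1)` written out. [folklore] -/
theorem ratPoly_eq (f : BinaryCubic ℤ) :
    f.ratPoly = C (f.a : ℚ) * X ^ 3 + C (f.b : ℚ) * X ^ 2 + C (f.c : ℚ) * X + C (f.d : ℚ) := rfl

/-- Evaluation of `f(u, 1)` at a rational number. [folklore] -/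
theorem eval_ratPoly (f : BinaryCubic ℤ) (r : ℚ) :
    f.ratPoly.eval r = f.a * r ^ 3 + f.b * r ^ 2 + f.c * r + f.d := by
  simp [ratPoly_eq]

/-- For `a ≠ 0`, `f(u, 1)` has degree `3`. [folklore] -/
theorem natDegree_ratPoly {f : BinaryCubic ℤ} (ha : f.a ≠ 0) : f.ratPoly.natDegree = 3 :=
  Cubic.natDegree_of_a_ne_zero (by simpa using ha)

/-- For `a ≠ 0`, `f(u, 1)` has degree `3`. [folklore] -/
theorem degree_ratPoly {f : BinaryCubic ℤ} (ha : f.a ≠ 0) : f.ratPoly.degree = 3 :=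
  Cubic.degree_of_a_ne_zero (by simpa using ha)

/-- For `a ≠ 0`, `f(u, 1) ≠ 0`. [folklore] -/
theorem ratPoly_ne_zero {f : BinaryCubic ℤ} (ha : f.a ≠ 0) : f.ratPoly ≠ 0 :=
  Cubic.ne_zero_of_a_ne_zero (by simpa using ha)

/-- **Irreducibility over `ℚ`** of an integral binary cubic form `f(u,v) = a u³ + b u²v + c uv² + d v³`
(BTT 2023, §2.2: "irreducible as a polynomial over `ℚ`"), in dehomogenized form: `v` does not
divide `f` (`a ≠ 0`) and `f(u, 1)` is irreducible in `ℚ[u]` — for a binary form, irreducibility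
is equivalent to that of its dehomogenization of the same degree; equivalently (`isIrreducible_iff_eval_ne_zero`)
`f` has no linear factor over `ℚ`, i.e. no zero in `P¹(ℚ)`. [cite: BhargavaTaniguchiThorne2023, §2.2 (irreducible cubic form)] -/
def IsIrreducible (f : BinaryCubic ℤ) : Prop :=
  f.a ≠ 0 ∧ Irreducible f.ratPoly

/-- A rational zero `r = m/n` of `f(u,1)` gives the primitive integral zero `(m, n)` of `f`. [folklore] -/
theorem eval_num_den_eq_zero {f : BinaryCubic ℤ} {r : ℚ} (hr : f.ratPoly.eval r = 0) :
    f.eval r.num r.den = 0 := by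
  have hn : (r.den : ℚ) ≠ 0 := by exact_mod_cast r.den_nz
  have hm : (r.num : ℚ) = r * r.den := (Rat.mul_den_eq_num r).symm
  have h : (f.eval r.num r.den : ℚ) = 0 := by
    rw [eval_ratPoly] at hr
    rw [eval]
    push_cast
    rw [hm]
    linear_combination (r.den : ℚ) ^ 3 * hr
  exact_mod_cast h

/-- An integral zero `(u, v)` with `v ≠ 0` gives the rational zero `u/v` of `f(u,1)`. [folklore] -/
theorem eval_ratPoly_div_eq_zero {f : BinaryCubic ℤ} {u v : ℤ} (hv : v ≠ 0) (h : f.eval u v = 0) :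
    f.ratPoly.eval ((u : ℚ) / v) = 0 := by
  have hv' : (v : ℚ) ≠ 0 := by exact_mod_cast hv
  have h' : (f.eval u v : ℚ) = 0 := by exact_mod_cast h
  rw [eval] at h'
  push_cast at h'
  rw [eval_ratPoly]
  field_simp
  linear_combination h'

/-- **`f` is irreducible over `ℚ` iff it has no zero in `P¹(ℚ)`**: `f(u, v) ≠ 0` for all integers
`(u, v) ≠ (0, 0)` (a binary cubic form is reducible iff it has a linear factor). [folklore] -/
theorem isIrreducible_iff_eval_ne_zero (f : BinaryCubic ℤ) :
    f.IsIrreducible ↔ ∀ u v : ℤ, (u ≠ 0 ∨ v ≠ 0) → f.eval u v ≠ 0 := by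
  constructor
  · rintro ⟨ha, hirr⟩ u v huv h
    by_cases hv : v = 0
    · subst hv
      have hu : u ≠ 0 := huv.resolve_right (fun h => h rfl)
      have : f.a * u ^ 3 = 0 := by simpa [eval] using h
      rcases mul_eq_zero.mp this with h1 | h1
      · exact ha h1
      · exact hu (pow_eq_zero_iff (by norm_num) |>.mp h1)
    · have hroot : f.ratPoly.IsRoot ((u : ℚ) / v) := eval_ratPoly_div_eq_zero hv h
      have h0 := (irreducible_iff_roots_eq_zero_of_degree_le_three
        (by rw [natDegree_ratPoly ha]; norm_num) (natDegree_ratPoly ha).le).mp hirr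
      have hmem : ((u : ℚ) / v) ∈ f.ratPoly.roots := (mem_roots (ratPoly_ne_zero ha)).mpr hroot
      rw [h0] at hmem
      exact Multiset.notMem_zero _ hmem
  · intro h
    have ha : f.a ≠ 0 := by
      have h10 := h 1 0 (Or.inl one_ne_zero)
      simpa [eval] using h10
    refine ⟨ha, ?_⟩
    rw [irreducible_iff_roots_eq_zero_of_degree_le_three (by rw [natDegree_ratPoly ha]; norm_num)
      (natDegree_ratPoly ha).le]
    refine Multiset.eq_zero_of_forall_notMem fun r hr => ?_
    have hroot : f.ratPoly.eval r = 0 := (mem_roots (ratPoly_ne_zero ha)).mp hr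
    exact h r.num r.den (Or.inr (by exact_mod_cast r.den_nz)) (eval_num_den_eq_zero hroot)

/-- The zero form is not irreducible. [folklore] -/
theorem not_isIrreducible_zero : ¬ (⟨0, 0, 0, 0⟩ : BinaryCubic ℤ).IsIrreducible := fun h => h.1 rfl

/-- Example: `u²v + v³ = v(u² + v²)` is reducible (divisible by `v`: `a = 0`). [folklore] -/
example : ¬ (⟨0, 1, 0, 1⟩ : BinaryCubic ℤ).IsIrreducible := fun h => h.1 rfl

end BinaryCubic

namespace RingOfForm

open BinaryCubic

variable {f : BinaryCubic ℤ}

/-- **If `a = 0` then `R(f)` has zero divisors**: `ω θ = −ad = 0` with `ω, θ ≠ 0` (the ring of a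
form divisible by `v` is not a domain; BTT Thm 2.1 clause 2, easy direction). [folklore] -/
theorem a_ne_zero_of_isDomain (f : BinaryCubic ℤ) [IsDomain (RingOfForm f)] : f.a ≠ 0 := by
  intro ha
  have h : omega f * theta f = 0 := by
    rw [omega_mul_theta, ha, zero_mul, neg_zero, Int.cast_zero]
  rcases mul_eq_zero.mp h with h1 | h1
  · exact one_ne_zero (show (1 : ℤ) = 0 from by simpa using congrArg RingOfForm.y h1)
  · exact one_ne_zero (show (1 : ℤ) = 0 from by simpa using congrArg RingOfForm.z h1)

/-- `R(f)` is not a domain when `a = 0`. [folklore] -/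
theorem not_isDomain_of_a_eq_zero (ha : f.a = 0) : ¬ IsDomain (RingOfForm f) :=
  fun _ => a_ne_zero_of_isDomain f ha

section Embedding

/-- The cubic `ℚ`-algebra `K_f = ℚ[x]/(f(x, 1))` (a field iff `f(u,1)` is irreducible; for
irreducible `f` the cubic field of `R(f)`). [folklore] -/
abbrev RatAlgebra (f : BinaryCubic ℤ) : Type := AdjoinRoot f.ratPoly

/-- The class `α` of `x` in `ℚ[x]/(f(x,1))`: `a α³ + b α² + c α + d = 0`. [folklore] -/
theorem ratPoly_root (f : BinaryCubic ℤ) :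
    (f.a : RatAlgebra f) * AdjoinRoot.root f.ratPoly ^ 3 + (f.b : RatAlgebra f) * AdjoinRoot.root f.ratPoly ^ 2
      + (f.c : RatAlgebra f) * AdjoinRoot.root f.ratPoly + (f.d : RatAlgebra f) = 0 := by
  have h : aeval (AdjoinRoot.root f.ratPoly)
      (C (f.a : ℚ) * X ^ 3 + C (f.b : ℚ) * X ^ 2 + C (f.c : ℚ) * X + C (f.d : ℚ)) = 0 := by
    rw [← ratPoly_eq, AdjoinRoot.aeval_eq, AdjoinRoot.mk_self]
  simpa [map_add, map_mul, map_pow, aeval_C, aeval_X, map_intCast] using h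

/-- **The embedding `R(f) → ℚ[x]/(f(x,1))`**: `x + yω + zθ ↦ x − y·aα − z·(aα² + bα + c)`; a ring
homomorphism because `ω = −aα`, `θ = −(aα² + bα + c)` satisfy `ωθ = −ad`, `ω² = −ac + bω − aθ`,
`θ² = −bd + dω − cθ` modulo `aα³ + bα² + cα + d = 0` (the classical realization of `R(f)` inside
`ℚ(α)`, Delone–Faddeev; GGS §4). [cite: GanGrossSavin2002, §4 (R(f) inside ℚ[x]/(f(x,1)))] -/
noncomputable def toAdjoinRoot (f : BinaryCubic ℤ) : RingOfForm f →+* RatAlgebra f where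
  toFun P := (P.x : RatAlgebra f) - (P.y : RatAlgebra f) * ((f.a : RatAlgebra f) * AdjoinRoot.root f.ratPoly)
    - (P.z : RatAlgebra f) * ((f.a : RatAlgebra f) * AdjoinRoot.root f.ratPoly ^ 2
        + (f.b : RatAlgebra f) * AdjoinRoot.root f.ratPoly + (f.c : RatAlgebra f))
  map_one' := by simp
  map_mul' P Q := by
    have hα := ratPoly_root f
    simp only [mul_x, mul_y, mul_z]
    push_cast
    linear_combination (-(((P.y : RatAlgebra f) * Q.z + (P.z : RatAlgebra f) * Q.y) * (f.a : RatAlgebra f)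
      + (P.z : RatAlgebra f) * Q.z * ((f.a : RatAlgebra f) * AdjoinRoot.root f.ratPoly + (f.b : RatAlgebra f)))) * hα
  map_zero' := by simp
  map_add' P Q := by
    simp only [add_x, add_y, add_z]
    push_cast
    ring

/-- The formula for `toAdjoinRoot`. [folklore] -/
theorem toAdjoinRoot_apply (P : RingOfForm f) :
    toAdjoinRoot f P = (P.x : RatAlgebra f) - (P.y : RatAlgebra f) * ((f.a : RatAlgebra f) * AdjoinRoot.root f.ratPoly)
      - (P.z : RatAlgebra f) * ((f.a : RatAlgebra f) * AdjoinRoot.root f.ratPoly ^ 2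
        + (f.b : RatAlgebra f) * AdjoinRoot.root f.ratPoly + (f.c : RatAlgebra f)) := rfl

/-- `toAdjoinRoot P` is the class of the polynomial `(x − cz) − (ay + bz)·X − az·X²`. [folklore] -/
theorem toAdjoinRoot_eq_mk (P : RingOfForm f) :
    toAdjoinRoot f P = AdjoinRoot.mk f.ratPoly
      (Cubic.toPoly ⟨0, -((f.a * P.z : ℤ) : ℚ), -((f.a * P.y + f.b * P.z : ℤ) : ℚ), ((P.x - f.c * P.z : ℤ) : ℚ)⟩) := by
  rw [toAdjoinRoot_apply, Cubic.toPoly]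
  simp only [map_add, map_mul, map_pow, AdjoinRoot.mk_C, AdjoinRoot.mk_X, map_neg, map_zero, zero_mul,
    zero_add]
  push_cast
  simp only [map_intCast, map_add, map_mul, map_sub]
  ring

/-- **The embedding is injective for `a ≠ 0`**: a polynomial of degree `≤ 2` divisible by the cubic
`f(x,1)` vanishes, and its coefficients `x − cz`, `ay + bz`, `az` determine `(x, y, z)`. [folklore] -/
theorem toAdjoinRoot_injective (ha : f.a ≠ 0) : Function.Injective (toAdjoinRoot f) := by
  rw [injective_iff_map_eq_zero]
  intro P hP
  rw [toAdjoinRoot_eq_mk, AdjoinRoot.mk_eq_zero] at hP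
  set q : Cubic ℚ := ⟨0, -((f.a * P.z : ℤ) : ℚ), -((f.a * P.y + f.b * P.z : ℤ) : ℚ), ((P.x - f.c * P.z : ℤ) : ℚ)⟩
    with hq
  have hq0 : q.toPoly = 0 := by
    refine Polynomial.eq_zero_of_dvd_of_degree_lt hP ?_
    calc q.toPoly.degree ≤ 2 := Cubic.degree_of_a_eq_zero rfl
      _ < 3 := by norm_num
      _ = f.ratPoly.degree := (degree_ratPoly ha).symm
  rw [Cubic.toPoly_eq_zero_iff] at hq0
  have hb : q.b = 0 := by rw [hq0]; rfl
  have hc : q.c = 0 := by rw [hq0]; rfl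
  have hd : q.d = 0 := by rw [hq0]; rfl
  simp only [hq, neg_eq_zero] at hb hc hd
  have hz : P.z = 0 := by
    have : f.a * P.z = 0 := by exact_mod_cast hb
    exact (mul_eq_zero.mp this).resolve_left ha
  have hy : P.y = 0 := by
    have : f.a * P.y + f.b * P.z = 0 := by exact_mod_cast hc
    rw [hz, mul_zero, add_zero] at this
    exact (mul_eq_zero.mp this).resolve_left ha
  have hx : P.x = 0 := by
    have : P.x - f.c * P.z = 0 := by exact_mod_cast hd
    rw [hz, mul_zero, sub_zero] at this
    exact this
  ext <;> simp [hx, hy, hz]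

end Embedding

/-- **`R(f)` is an integral domain when `f` is irreducible over `ℚ`**: it embeds in the field
`ℚ[x]/(f(x,1))` (BTT Thm 2.1 clause 2, one direction). [cite: BhargavaTaniguchiThorne2023, Theorem 2.1 (irreducible forms ↔ orders in cubic fields)] -/
theorem isDomain_of_isIrreducible (h : f.IsIrreducible) : IsDomain (RingOfForm f) := by
  haveI : Fact (Irreducible f.ratPoly) := ⟨h.2⟩
  exact (toAdjoinRoot_injective h.1).isDomain (toAdjoinRoot f)

/-- **If `R(f)` is an integral domain then `f` is irreducible over `ℚ`**: otherwise `f` has a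
primitive integral zero `(m, n)`; completing it to `γ = (m n; ∗ ∗) ∈ SL₂(ℤ)` gives
`R(f) ≅ R(f ∘ γ)` (`DeloneFaddeevEquivariance`) with `(f ∘ γ)` having `a = f(m, n) = 0`, whose ring
has the zero divisors `ω θ = 0` (BTT Thm 2.1 clause 2, other direction). [cite: BhargavaTaniguchiThorne2023, Theorem 2.1 (irreducible forms ↔ orders in cubic fields)] -/
theorem isIrreducible_of_isDomain (f : BinaryCubic ℤ) [IsDomain (RingOfForm f)] : f.IsIrreducible := by
  have ha : f.a ≠ 0 := a_ne_zero_of_isDomain f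
  -- `f` has no PRIMITIVE integral zero `(m, n)`
  have key : ∀ m n : ℤ, IsCoprime m n → f.eval m n ≠ 0 := by
    intro m n hmn h
    obtain ⟨u, v, huv⟩ := hmn
    -- `γ = (m n; -v u) ∈ SL₂(ℤ)` and `(f ∘ γ).a = f(m, n) = 0`
    let γ : Matrix (Fin 2) (Fin 2) ℤ := !![m, n; -v, u]
    have hdet : γ.det = 1 := by
      rw [Matrix.det_fin_two_of]
      linear_combination huv
    have hga : (f.subst γ).a = 0 := by
      rw [← h]
      simp [BinaryCubic.subst, BinaryCubic.eval, γ]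
    obtain ⟨e⟩ := nonempty_ringEquiv_subst_of_det_eq_one hdet f
    haveI : IsDomain (RingOfForm (f.subst γ)) := MulEquiv.isDomain (RingOfForm f) e.toMulEquiv
    exact a_ne_zero_of_isDomain (f.subst γ) hga
  rw [isIrreducible_iff_eval_ne_zero]
  intro u v huv h
  by_cases hv : v = 0
  · subst hv
    have : f.a * u ^ 3 = 0 := by simpa [BinaryCubic.eval] using h
    rcases mul_eq_zero.mp this with h1 | h1
    · exact ha h1
    · exact (huv.resolve_right fun h => h rfl) (pow_eq_zero_iff (by norm_num) |>.mp h1)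
  · -- a zero with `v ≠ 0` gives the rational root `u/v`, whose reduced fraction is a primitive zero
    have hroot := eval_ratPoly_div_eq_zero hv h
    refine key ((u : ℚ) / v).num ((u : ℚ) / v).den ?_ (eval_num_den_eq_zero hroot)
    rw [Int.isCoprime_iff_gcd_eq_one, Int.gcd_eq_natAbs, Int.natAbs_natCast]
    exact ((u : ℚ) / v).reduced

/-- **Levi–Delone–Faddeev, clause 2** (BTT 2023, Thm 2.1): under `f ↦ R(f)`, irreducible cubic
forms correspond exactly to cubic rings that are integral domains (= orders in cubic fields).
[cite: BhargavaTaniguchiThorne2023, Theorem 2.1 (irreducible cubic forms correspond to orders in cubic fields)] -/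
theorem isDomain_iff_isIrreducible (f : BinaryCubic ℤ) : IsDomain (RingOfForm f) ↔ f.IsIrreducible :=
  ⟨fun _ => isIrreducible_of_isDomain f, isDomain_of_isIrreducible⟩

/-- Irreducibility is a `GL₂(ℤ)`-invariant (through the rings). [folklore] -/
theorem _root_.Literature.NumberTheory.CubicFields.BinaryCubic.GL2ZEquiv.isIrreducible_iff
    {f g : BinaryCubic ℤ} (h : GL2ZEquiv f g) : f.IsIrreducible ↔ g.IsIrreducible := by
  obtain ⟨e⟩ := nonempty_ringEquiv_of_gl2zEquiv h
  rw [← isDomain_iff_isIrreducible, ← isDomain_iff_isIrreducible]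
  exact (MulEquiv.isDomain_iff e.toMulEquiv).symm

end RingOfForm

end Literature.NumberTheory.CubicFields
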